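import Summits.ABC.ABC.Theorems.TwistAmplificationSharpModerateLawSyzygyTransfer
import Summits.ABC.ABC.Theorems.TwistAmplificationSharpModerateLawConeDefs

/-!
# Crux `TwistAmplification.SharpModerateLaw` (stmt-ABC-1975), line `syzygy-lattice-half-deep-few-primes`:
cone-restricted dictionary step and cone-restricted few-deep/spread split

* `syzygyTransferCone : SyzygyTransferCone` (`IndexFormShellLawCone → CuspShellLawCone`): the landed dictionary
  (`ncard_cuspShell_le : #cuspShell X Y ≤ totalCount ⊤ X (186624·Y)`, file `…SyzygyTransfer.lean`) maps the cusp cone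
  `X³ ≤ 2Y ≤ 2X^σ` into the index-form cone `X³ ≤ 2Y' ∧ Y' ≤ 186624·X^σ`, `Y' = 186624·Y`;
* `indexFormShellLawCone_of_split : FewDeepLawCone → SpreadLawCone → IndexFormShellLawCone` (same union bound as the
  unrestricted `indexFormShellLaw_of_split` of the skeleton).
Together with `cuspTransferCone` (file `…CuspTransferCone.lean`) and `fewDeepLawCone_of_fewDeepLaw` this shows that the crux
follows from the banked stubs and the CONE-restricted spread law `SpreadLawCone` alone — the honest minimal open core.
-/

noncomputable section

namespace Summit.ABC.ABC.Theorems.SharpModerateLaw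

open Literature.NumberTheory.CubicFields
open scoped BigOperators

/-- **`syzygyTransferCone`** (registered sub-goal): the cone-restricted index-form shell law implies the cone-restricted
cusp shell law, constant `max C 0 · 186624^ε`. -/
theorem syzygyTransferCone : SyzygyTransferCone := by
  intro hIF σ hσ ε hε
  obtain ⟨C, hC⟩ := hIF σ hσ ε hε
  refine ⟨max C 0 * (186624 : ℝ) ^ ε, fun X Y hX hY hc1 hc2 => ?_⟩
  have hX0 : 0 < X := by linarith
  have hY0 : 0 < Y := by linarith
  have hc1' : X ^ 3 ≤ 2 * (186624 * Y) := by linarith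
  have hc2' : 186624 * Y ≤ 186624 * X ^ σ := by linarith
  have h1 := hC X (186624 * Y) hX (by linarith) hc1' hc2'
  have e1 : (X * (186624 * Y)) ^ ε = (186624 : ℝ) ^ ε * (X * Y) ^ ε := by
    rw [show X * (186624 * Y) = 186624 * (X * Y) by ring]; exact Real.mul_rpow (by norm_num) (by positivity)
  have e2 : (186624 * Y) ^ (-(1 / 6 : ℝ)) ≤ Y ^ (-(1 / 6 : ℝ)) := by
    rw [Real.mul_rpow (by norm_num) hY0.le]
    have h6 : (186624 : ℝ) ^ (-(1 / 6 : ℝ)) ≤ 1 := Real.rpow_le_one_of_one_le_of_nonpos (by norm_num) (by norm_num)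
    have h0 : 0 ≤ Y ^ (-(1 / 6 : ℝ)) := Real.rpow_nonneg hY0.le _
    nlinarith
  have hE : 0 ≤ (X * (186624 * Y)) ^ ε := Real.rpow_nonneg (by positivity) ε
  have hA : 0 ≤ X * (186624 * Y) ^ (-(1 / 6 : ℝ)) + 1 := by positivity
  have hA' : X * (186624 * Y) ^ (-(1 / 6 : ℝ)) + 1 ≤ X * Y ^ (-(1 / 6 : ℝ)) + 1 := by
    nlinarith [mul_le_mul_of_nonneg_left e2 hX0.le]
  calc ((cuspShell X Y).ncard : ℝ)
      ≤ (totalCount (fun _ _ _ _ => True) X (186624 * Y) : ℝ) := by exact_mod_cast ncard_cuspShell_le X Y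
    _ ≤ C * (X * (186624 * Y)) ^ ε * (X * (186624 * Y) ^ (-(1 / 6 : ℝ)) + 1) := h1
    _ ≤ max C 0 * (X * (186624 * Y)) ^ ε * (X * Y ^ (-(1 / 6 : ℝ)) + 1) :=
        mul_le_mul (mul_le_mul_of_nonneg_right (le_max_left _ _) hE) hA' hA (mul_nonneg (le_max_right _ _) hE)
    _ = max C 0 * (186624 : ℝ) ^ ε * (X * Y) ^ ε * (X * Y ^ (-(1 / 6 : ℝ)) + 1) := by rw [e1]; ring

/-- Orbit sums are subadditive in the weight (finite sum for `D ≠ 0`). -/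
theorem orbitTotal_le_add' {D : ℤ} (hD : D ≠ 0) {w w₁ w₂ : BinaryCubic ℤ → ℕ}
    (h : ∀ F, w F ≤ w₁ F + w₂ F) : orbitTotal D w ≤ orbitTotal D w₁ + orbitTotal D w₂ := by
  haveI : Finite (orbitsOfDisc D) := finite_orbitsOfDisc hD
  haveI : Fintype (orbitsOfDisc D) := Fintype.ofFinite _
  simp only [orbitTotal, finsum_eq_sum_of_fintype, ← Finset.sum_add_distrib]
  exact Finset.sum_le_sum fun O _ => h _

/-- Every shell count splits as few-deep + spread. -/
theorem shellCount_le_split' (X Y : ℝ) (F : BinaryCubic ℤ) :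
    shellCount (fun _ _ _ _ => True) X Y F ≤
      shellCount FewDeep X Y F + shellCount (fun X Y F q => ¬ FewDeep X Y F q) X Y F := by
  unfold shellCount
  have hsplit : {q : ℤ × ℤ | RingOfForm.IsMaximal F ∧ q ∈ ifShell F X Y ∧ True} =
      {q : ℤ × ℤ | RingOfForm.IsMaximal F ∧ q ∈ ifShell F X Y ∧ FewDeep X Y F q} ∪
        {q : ℤ × ℤ | RingOfForm.IsMaximal F ∧ q ∈ ifShell F X Y ∧ ¬ FewDeep X Y F q} := by
    ext q
    simp only [Set.mem_setOf_eq, Set.mem_union, and_true]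
    tauto
  rw [hsplit]
  exact Set.ncard_union_le _ _

/-- The total count splits as few-deep + spread. -/
theorem totalCount_le_split' (X Y : ℝ) :
    totalCount (fun _ _ _ _ => True) X Y ≤
      totalCount FewDeep X Y + totalCount (fun X Y F q => ¬ FewDeep X Y F q) X Y := by
  unfold totalCount
  rw [← Finset.sum_add_distrib]
  refine Finset.sum_le_sum fun D hD => ?_
  exact orbitTotal_le_add' (Finset.mem_erase.mp hD).1 fun F => shellCount_le_split' X Y F

/-- **Cone split**: `FewDeepLawCone ∧ SpreadLawCone ⇒ IndexFormShellLawCone` (constants `max C₁ 0 + max C₂ 0`). -/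
theorem indexFormShellLawCone_of_split (h₁ : FewDeepLawCone) (h₂ : SpreadLawCone) : IndexFormShellLawCone := by
  intro σ hσ ε hε
  obtain ⟨C₁, hC₁⟩ := h₁ σ hσ ε hε
  obtain ⟨C₂, hC₂⟩ := h₂ σ hσ ε hε
  refine ⟨max C₁ 0 + max C₂ 0, fun X Y hX hY hc1 hc2 => ?_⟩
  have hX0 : 0 < X := by linarith
  have hY0 : 0 < Y := by linarith
  have h1 := hC₁ X Y hX hY hc1 hc2
  have h2 := hC₂ X Y hX hY hc1 hc2
  have hsplit : (totalCount (fun _ _ _ _ => True) X Y : ℝ) ≤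
      (totalCount FewDeep X Y : ℝ) + (totalCount (fun X Y F q => ¬ FewDeep X Y F q) X Y : ℝ) := by
    exact_mod_cast totalCount_le_split' X Y
  set E : ℝ := (X * Y) ^ ε with hE_def
  set A : ℝ := X * Y ^ (-(1 / 6 : ℝ)) with hA_def
  have hE : 0 ≤ E := Real.rpow_nonneg (by positivity) ε
  have hA : 0 ≤ A := by positivity
  have s1 : C₁ * E * (A + 0) ≤ max C₁ 0 * E * (A + 1) := by
    have t1 : C₁ * E * (A + 0) ≤ max C₁ 0 * E * (A + 0) :=
      mul_le_mul_of_nonneg_right (mul_le_mul_of_nonneg_right (le_max_left _ _) hE) (by linarith)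
    have t2 : max C₁ 0 * E * (A + 0) ≤ max C₁ 0 * E * (A + 1) :=
      mul_le_mul_of_nonneg_left (by linarith) (mul_nonneg (le_max_right _ _) hE)
    linarith
  have s2 : C₂ * E * (A + 1) ≤ max C₂ 0 * E * (A + 1) :=
    mul_le_mul_of_nonneg_right (mul_le_mul_of_nonneg_right (le_max_left _ _) hE) (by linarith)
  calc (totalCount (fun _ _ _ _ => True) X Y : ℝ)
      ≤ (totalCount FewDeep X Y : ℝ) + (totalCount (fun X Y F q => ¬ FewDeep X Y F q) X Y : ℝ) := hsplit
    _ ≤ C₁ * E * (A + 0) + C₂ * E * (A + 1) := add_le_add h1 h2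
    _ ≤ max C₁ 0 * E * (A + 1) + max C₂ 0 * E * (A + 1) := add_le_add s1 s2
    _ = (max C₁ 0 + max C₂ 0) * E * (A + 1) := by ring

/-- **Cone composition, abstract form**: the crux follows from the cone cusp transfer, the cone dictionary step,
the (unrestricted) few-deep law and the CONE-restricted spread law. -/
theorem sharpModerateLaw_of_coneCore (hT : CuspTransferCone) (hS : SyzygyTransferCone) (hF : FewDeepLaw)
    (hSp : SpreadLawCone) : Summit.ABC.ABC.Theses.TwistAmplification.SharpModerateLaw :=
  hT (hS (indexFormShellLawCone_of_split (fewDeepLawCone_of_fewDeepLaw hF) hSp))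

end Summit.ABC.ABC.Theorems.SharpModerateLaw

end
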